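import Literature.NumberTheory.EllipticCurves.FormalGroupLawPadicProofs
import Literature.NumberTheory.EllipticCurves.FormalGroupMultiplication
import Literature.NumberTheory.EllipticCurves.PadicSeriesIdentityMvProofs
import HarnessLib

/-!
# The chord–tangent coordinates on the formal group: `x(u +_F v)`, `y(u +_F v)`, `x([2]t)`,
# `y([2]t)` as formal identities over `ℤ_p` (Silverman AEC III.2.3 + IV.1, VII.2.2; proofs only)

Trunk T-NT-EC (Literature/NumberTheory/EllipticCurves). Pure proof file. The tree proves that the
chord–tangent formal group law `F = formalGroupLaw` of a Weierstrass curve COMPUTES the group law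
on the kernel of reduction `E₁(ℚ_p)` (`FormalGroupLawPadicProofs.formalGroupLaw_padicEval_holds`,
Silverman AEC VII.2.2: `F(z(P), z(Q)) = z(P + Q)`), and that `[n](z(P)) = z(nP)`
(`FormalGroupMultiplication`). Here these statements AT POINTS are turned, by the identity theorem
for integral power series (`PadicSeriesIdentityMvProofs`), into the four IDENTITIES OF POWER
SERIES WITH `ℤ_p`-COEFFICIENTS saying that the formal point `(x(z), y(z)) = (X(z)/z², −X(z)/z³)`
(`X = formalXMulSq`) is added and doubled by Mathlib's affine addition formulas
(`WeierstrassCurve.Affine.addX/addY`, AEC III.2.3) — with all poles cleared: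

* `formalXMulSq_formalGroupLaw_chord` (**`x(u +_F v)`**): with `X₀ = X(u)`, `X₁ = X(v)`,
  `N = X₀v² − X₁u²` (`= u²v²(x₁ − x₂)`), `M = X₁u³ − X₀v³` (`= u³v³(y₁ − y₂)`),
  `X(F)·N²·u²v² = F²·(M² + a₁MNuv − (a₂u²v² + X₀v² + X₁u²)·N²)`, i.e.
  `x₃(x₁ − x₂)² = (y₁ − y₂)² + a₁(y₁ − y₂)(x₁ − x₂) − (a₂ + x₁ + x₂)(x₁ − x₂)²`;
* `formalXMulSq_formalGroupLaw_chordY` (**`y(u +_F v)`**):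
  `(−X(F) + a₁X(F)F + a₃F³)·N·u³v = −M·(X(F)u² − X₀F²)·F + X₀·N·F³·v`, i.e.
  `(y₃ + a₁x₃ + a₃)(x₁ − x₂) = −(y₁ − y₂)(x₃ − x₁) − y₁(x₁ − x₂)`;
* `formalXMulSq_formalMul_two` (**`x([2]t)`**): with `D = [2](t)`, `Ỹ = (a₁t − 2)X + a₃t³`
  (`= t³(2y + a₁x + a₃)`, `formalYTilde`) and `Mt = 3X² + 2a₂t²X + a₄t⁴ + a₁tX`
  (`= t⁴(3x² + 2a₂x + a₄ − a₁y)`): `X(D)·t²·Ỹ² = D²·(Mt² + a₁·Mt·t·Ỹ − a₂t²Ỹ² − 2XỸ²)`;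
* `formalXMulSq_formalMul_twoY` (**`y([2]t)`**):
  `(−X(D) + a₁X(D)D + a₃D³)·t³·Ỹ = −Mt·(X(D)t² − X·D²)·D + X·D³·Ỹ`.

They hold for every Weierstrass equation over `ℤ_p` whose generic fibre is an elliptic curve,
and therefore — after `map` to `ℤ/p` and substitution of a formal parameter — they say that the
reduction `F̃` of `F` computes Mathlib's addition of the formal points of `Ẽ` over Laurent-series
fields `k((s))` (the use made of them in `FormalGroupFrobeniusTypeProofs`). The proofs: at a point
`(t₁, t₂) = (z(P), z(Q))` of the open unit polydisc (every point is of this form,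
`exists_isInReductionKernel_formalParameter_eq`) both sides evaluate, through the dictionary
`X̂(z(R)) = x(R)z(R)²`, `F̂(z(P), z(Q)) = z(P + Q)`, `[2]^(z(P)) = z(2P)`, to the two sides of the
affine addition formula multiplied by a factor which vanishes exactly in the degenerate
configurations (`P = O`, `Q = O`, `x(P) = x(Q)`, resp. `2P = O`), where both sides are `0`; so the
two integral series agree on the polydisc and are equal (`eq_of_evalHom₂_eq`).

## Sources

* J. H. Silverman, *The Arithmetic of Elliptic Curves*, 2nd ed. (2009), III.2.3 (group law
  algorithm: `x₃ = λ² + a₁λ − a₂ − x₁ − x₂`, `y₃ = −(λ + a₁)x₃ − ν − a₃`), IV.1–IV.2 (the formal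
  group law computes the group law formally: "`(x(z), y(z))` … with `z = F(z₁, z₂)` is the sum"),
  VII.2.2. [SilvermanAEC2009]

## Design notes

* Statements over `ℤ_p` (`V : WeierstrassCurve ℤ_[p]` with `(V.map PadicInt.Coe.ringHom)`
  elliptic), so that they can be reduced modulo `p` by `map`; proofs by transport to the
  `p`-integral curve `V.map PadicInt.Coe.ringHom` over `ℚ_p`, where the tree's `p`-adic evaluation
  and identity theorems live. Evaluation of `ℤ_p`-series is the ring homomorphism `evalHom₂`
  (`PadicSeriesEvaluation`), bridged to `padicEval₂` of the `ℚ_p`-series by `padicEval₂_map`.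
* The pointwise algebra is Mathlib's `addX`, `addY`, `slope_of_X_ne`, `slope_of_Y_ne`, cleared of
  denominators (`chord_addX_mul`, …); no new definitions and no named facts.
-/

noncomputable section

open scoped Classical
open PowerSeries Literature.NumberTheory.EllipticCurves

namespace WeierstrassCurve

/-! ### The affine addition formulas, denominators cleared -/

section Algebra

variable {K : Type*} [Field K] (W : WeierstrassCurve K)

/-- **Chord, `x`-coordinate**: `x₃(x₁ − x₂)² = (y₁ − y₂)² + a₁(y₁ − y₂)(x₁ − x₂) −
(a₂ + x₁ + x₂)(x₁ − x₂)²` for Mathlib's `x₃ = addX x₁ x₂ (slope …)`, `x₁ ≠ x₂`.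
[Silverman AEC III.2.3] [folklore] -/
theorem chord_addX_mul {x₁ x₂ : K} (y₁ y₂ : K) (hx : x₁ ≠ x₂) :
    W.toAffine.addX x₁ x₂ (W.toAffine.slope x₁ x₂ y₁ y₂) * (x₁ - x₂) ^ 2 =
      (y₁ - y₂) ^ 2 + W.a₁ * (y₁ - y₂) * (x₁ - x₂) - (W.a₂ + x₁ + x₂) * (x₁ - x₂) ^ 2 := by
  rw [Affine.slope_of_X_ne hx]
  have hx' : x₁ - x₂ ≠ 0 := sub_ne_zero.mpr hx
  simp only [Affine.addX]
  field_simp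
  ring

/-- **Chord, `y`-coordinate**: `(y₃ + a₁x₃ + a₃)(x₁ − x₂) = −(y₁ − y₂)(x₃ − x₁) − y₁(x₁ − x₂)` for
Mathlib's `y₃ = addY x₁ x₂ y₁ (slope …)`, `x₁ ≠ x₂`. [Silverman AEC III.2.3] [folklore] -/
theorem chord_addY_mul {x₁ x₂ : K} (y₁ y₂ : K) (hx : x₁ ≠ x₂) :
    (W.toAffine.addY x₁ x₂ y₁ (W.toAffine.slope x₁ x₂ y₁ y₂) +
        W.a₁ * W.toAffine.addX x₁ x₂ (W.toAffine.slope x₁ x₂ y₁ y₂) + W.a₃) * (x₁ - x₂) =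
      -(y₁ - y₂) * (W.toAffine.addX x₁ x₂ (W.toAffine.slope x₁ x₂ y₁ y₂) - x₁) - y₁ * (x₁ - x₂) := by
  rw [Affine.slope_of_X_ne hx]
  have hx' : x₁ - x₂ ≠ 0 := sub_ne_zero.mpr hx
  simp only [Affine.addY, Affine.negAddY, Affine.negY, Affine.addX]
  field_simp
  ring

/-- **Tangent, `x`-coordinate**: with `D = y − negY x y = 2y + a₁x + a₃ ≠ 0` and
`N = 3x² + 2a₂x + a₄ − a₁y`: `x([2]P)·D² = N² + a₁ND − (a₂ + 2x)D²`.
[Silverman AEC III.2.3 (duplication)] [folklore] -/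
theorem tangent_addX_mul {x y : K} (hy : y ≠ W.toAffine.negY x y) :
    W.toAffine.addX x x (W.toAffine.slope x x y y) * (y - W.toAffine.negY x y) ^ 2 =
      (3 * x ^ 2 + 2 * W.a₂ * x + W.a₄ - W.a₁ * y) ^ 2 +
        W.a₁ * (3 * x ^ 2 + 2 * W.a₂ * x + W.a₄ - W.a₁ * y) * (y - W.toAffine.negY x y) -
        (W.a₂ + 2 * x) * (y - W.toAffine.negY x y) ^ 2 := by
  rw [Affine.slope_of_Y_ne rfl hy]
  have hy' : y - W.toAffine.negY x y ≠ 0 := sub_ne_zero.mpr hy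
  simp only [Affine.addX]
  field_simp
  ring

/-- **Tangent, `y`-coordinate**: `(y([2]P) + a₁x([2]P) + a₃)·D = −N·(x([2]P) − x) − y·D`.
[Silverman AEC III.2.3 (duplication)] [folklore] -/
theorem tangent_addY_mul {x y : K} (hy : y ≠ W.toAffine.negY x y) :
    (W.toAffine.addY x x y (W.toAffine.slope x x y y) +
        W.a₁ * W.toAffine.addX x x (W.toAffine.slope x x y y) + W.a₃) * (y - W.toAffine.negY x y) =
      -(3 * x ^ 2 + 2 * W.a₂ * x + W.a₄ - W.a₁ * y) *
          (W.toAffine.addX x x (W.toAffine.slope x x y y) - x) - y * (y - W.toAffine.negY x y) := by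
  rw [Affine.slope_of_Y_ne rfl hy]
  have hy' : y - W.toAffine.negY x y ≠ 0 := sub_ne_zero.mpr hy
  simp only [Affine.addY, Affine.negAddY, Affine.addX]
  generalize W.toAffine.negY x y = n at hy' ⊢
  simp only [Affine.negY]
  field_simp
  ring

end Algebra

/-! ### Evaluation of `ℤ_p`-series: the identity theorem in `evalHom` form, and the dictionary -/

section Bridge

variable {p : ℕ} [Fact p.Prime]

/-- `evalHom₂` on a variable. [folklore] -/
@[simp] theorem _root_.Literature.NumberTheory.EllipticCurves.evalHom₂_X (u v : ℤ_[p])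
    (hu : ‖u‖ < 1) (hv : ‖v‖ < 1) (i : Fin 2) :
    evalHom₂ u v hu hv (MvPowerSeries.X i) = ![u, v] i := by
  rw [evalHom₂_apply, MvPowerSeries.eval₂_X]

/-- `evalHom₂` on a constant. [folklore] -/
@[simp] theorem _root_.Literature.NumberTheory.EllipticCurves.evalHom₂_C (u v : ℤ_[p])
    (hu : ‖u‖ < 1) (hv : ‖v‖ < 1) (c : ℤ_[p]) :
    evalHom₂ u v hu hv (MvPowerSeries.C c) = c := by
  rw [evalHom₂_apply, MvPowerSeries.eval₂_C, RingHom.id_apply]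

/-- `evalHom` on the variable. [folklore] -/
@[simp] theorem _root_.Literature.NumberTheory.EllipticCurves.evalHom_X (t : ℤ_[p]) (ht : ‖t‖ < 1) :
    evalHom t ht (PowerSeries.X : ℤ_[p]⟦X⟧) = t := by
  rw [evalHom_apply, PowerSeries.eval₂_X]

/-- `evalHom` on a constant. [folklore] -/
@[simp] theorem _root_.Literature.NumberTheory.EllipticCurves.evalHom_C (t : ℤ_[p]) (ht : ‖t‖ < 1)
    (c : ℤ_[p]) : evalHom t ht (PowerSeries.C c) = c := by
  rw [evalHom_apply, PowerSeries.eval₂_C, RingHom.id_apply]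

/-- **Identity theorem for `ℤ_p⟦u, v⟧` in `evalHom₂` form**: two series with the same values at all
pairs of points of the open unit disc of `ℤ_p` are equal. [folklore] -/
theorem _root_.Literature.NumberTheory.EllipticCurves.eq_of_evalHom₂_eq
    {G H : MvPowerSeries (Fin 2) ℤ_[p]}
    (h : ∀ (u v : ℤ_[p]) (hu : ‖u‖ < 1) (hv : ‖v‖ < 1), evalHom₂ u v hu hv G = evalHom₂ u v hu hv H) :
    G = H := by
  suffices hGH : G.map PadicInt.Coe.ringHom = H.map PadicInt.Coe.ringHom by
    ext d
    have := congrArg (MvPowerSeries.coeff d) hGH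
    rw [MvPowerSeries.coeff_map, MvPowerSeries.coeff_map] at this
    exact Subtype.ext this
  refine eq_of_padicEvalMv_eq (isPadicInt_map G) (isPadicInt_map H) fun pt hpt => ?_
  have hpt' : pt = ![pt 0, pt 1] := by funext i; fin_cases i <;> rfl
  obtain ⟨u, hu', hu⟩ := exists_coe_eq_of_norm_lt_one (hpt 0)
  obtain ⟨v, hv', hv⟩ := exists_coe_eq_of_norm_lt_one (hpt 1)
  rw [hpt', ← padicEval₂_eq_padicEvalMv, ← padicEval₂_eq_padicEvalMv, ← hu', ← hv',
    padicEval₂_map G hu hv, padicEval₂_map H hu hv, h u v hu hv]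

/-- **Identity theorem for `ℤ_p⟦t⟧` in `evalHom` form.** [folklore] -/
theorem _root_.Literature.NumberTheory.EllipticCurves.eq_of_evalHom_eq {G H : ℤ_[p]⟦X⟧}
    (h : ∀ (t : ℤ_[p]) (ht : ‖t‖ < 1), evalHom t ht G = evalHom t ht H) : G = H := by
  suffices hGH : G.map PadicInt.Coe.ringHom = H.map PadicInt.Coe.ringHom by
    ext d
    have := congrArg (PowerSeries.coeff d) hGH
    rw [PowerSeries.coeff_map, PowerSeries.coeff_map] at this
    exact Subtype.ext this
  refine eq_of_padicEval_eq (isPadicInt_map G) (isPadicInt_map H) fun t ht => ?_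
  obtain ⟨t', ht', ht''⟩ := exists_coe_eq_of_norm_lt_one ht
  rw [← ht', padicEval_map G ht'', padicEval_map H ht'', h t' ht'']

variable (V : WeierstrassCurve ℤ_[p])

/-- The generic fibre of `V/ℤ_p` is a `p`-integral equation. [folklore] -/
theorem isIntegral_map_coe : (V.map PadicInt.Coe.ringHom).IsIntegral ℤ_[p] :=
  ⟨⟨V, by rw [baseChange, algebraMap_padicInt_eq]⟩⟩

/-- Dictionary: `X(u)` evaluated. [folklore] -/
theorem evalHom₂_formalXMulSq_subst_X (u v : ℤ_[p]) (hu : ‖u‖ < 1) (hv : ‖v‖ < 1) (i : Fin 2) :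
    (evalHom₂ u v hu hv (V.formalXMulSq.subst (MvPowerSeries.X i : MvPowerSeries (Fin 2) ℤ_[p])) :
        ℚ_[p]) =
      padicEval (V.map PadicInt.Coe.ringHom).formalXMulSq (![(u : ℚ_[p]), v] i) := by
  haveI := V.isIntegral_map_coe
  rw [← padicEval₂_map _ hu hv, PowerSeries.map_subst (PowerSeries.HasSubst.X i), map_formalXMulSq,
    MvPowerSeries.map_X, padicEval₂_subst_X (V.map PadicInt.Coe.ringHom).isPadicInt_formalXMulSq hu hv]

/-- Dictionary: `F(u, v)` evaluated. [folklore] -/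
theorem evalHom₂_formalGroupLaw (u v : ℤ_[p]) (hu : ‖u‖ < 1) (hv : ‖v‖ < 1) :
    (evalHom₂ u v hu hv V.formalGroupLaw : ℚ_[p]) =
      padicEval₂ (V.map PadicInt.Coe.ringHom).formalGroupLaw u v := by
  rw [← padicEval₂_map _ hu hv, map_formalGroupLaw]

/-- Dictionary: `X(F(u, v))` evaluated. [folklore] -/
theorem evalHom₂_formalXMulSq_subst_formalGroupLaw (u v : ℤ_[p]) (hu : ‖u‖ < 1) (hv : ‖v‖ < 1) :
    (evalHom₂ u v hu hv (V.formalXMulSq.subst V.formalGroupLaw) : ℚ_[p]) =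
      padicEval (V.map PadicInt.Coe.ringHom).formalXMulSq
        (padicEval₂ (V.map PadicInt.Coe.ringHom).formalGroupLaw u v) := by
  haveI := V.isIntegral_map_coe
  rw [← padicEval₂_map _ hu hv, PowerSeries.map_subst V.hasSubst_formalGroupLaw, map_formalXMulSq,
    map_formalGroupLaw]
  exact padicEval₂_subst (V.map PadicInt.Coe.ringHom).isPadicInt_formalXMulSq
    (V.map PadicInt.Coe.ringHom).isPadicInt_formalGroupLaw
    (V.map PadicInt.Coe.ringHom).constantCoeff_formalGroupLaw hu hv

/-- Dictionary, one variable: `X(t)` evaluated. [folklore] -/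
theorem evalHom_formalXMulSq (t : ℤ_[p]) (ht : ‖t‖ < 1) :
    (evalHom t ht V.formalXMulSq : ℚ_[p]) = padicEval (V.map PadicInt.Coe.ringHom).formalXMulSq t := by
  rw [← padicEval_map _ ht, map_formalXMulSq]

/-- Dictionary, one variable: `[2](t)` evaluated. [folklore] -/
theorem evalHom_formalMul_two (t : ℤ_[p]) (ht : ‖t‖ < 1) :
    (evalHom t ht (V.formalMul 2) : ℚ_[p]) = padicEval ((V.map PadicInt.Coe.ringHom).formalMul 2) t := by
  rw [← padicEval_map _ ht, map_formalMul]

/-- Dictionary, one variable: `X([2](t))` evaluated. [folklore] -/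
theorem evalHom_formalXMulSq_subst_formalMul_two (t : ℤ_[p]) (ht : ‖t‖ < 1) :
    (evalHom t ht (V.formalXMulSq.subst (V.formalMul 2)) : ℚ_[p]) =
      padicEval (V.map PadicInt.Coe.ringHom).formalXMulSq
        (padicEval ((V.map PadicInt.Coe.ringHom).formalMul 2) t) := by
  haveI := V.isIntegral_map_coe
  rw [← padicEval_map _ ht,
    powerSeries_map_subst (PowerSeries.HasSubst.of_constantCoeff_zero' (V.constantCoeff_formalMul 2)),
    map_formalXMulSq, map_formalMul,
    padicEval_subst (V.map PadicInt.Coe.ringHom).isPadicInt_formalXMulSq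
      ((V.map PadicInt.Coe.ringHom).isPadicInt_formalMul 2)
      ((V.map PadicInt.Coe.ringHom).constantCoeff_formalMul 2) ht]

end Bridge

/-! ### The identities at points of the unit polydisc -/

section Pointwise

variable {p : ℕ} [Fact p.Prime] {W : WeierstrassCurve ℚ_[p]} [hW : W.IsIntegral ℤ_[p]]
  [W.IsElliptic] {t₁ t₂ : ℚ_[p]}

/-- **`x(P + Q)` at a pair of parameters**: for `(t₁, t₂)` in the open unit polydisc, with
`Xᵢ = X̂(tᵢ)`, `F = F̂(t₁, t₂)`:
`X̂(F)·(X₁t₂² − X₂t₁²)²·t₁²t₂² = F²·(M² + a₁MNt₁t₂ − (a₂t₁²t₂² + X₁t₂² + X₂t₁²)N²)`,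
`N = X₁t₂² − X₂t₁²`, `M = X₂t₁³ − X₁t₂³`. At `(z(P), z(Q))` with `x(P) ≠ x(Q)` this is
`chord_addX_mul` transported by the dictionary; in the degenerate configurations (`tᵢ = 0`,
`x(P) = x(Q)`) both sides vanish. [Silverman AEC III.2.3, IV.1, VII.2.2] [folklore] -/
theorem chordX_pointwise (h₁ : ‖t₁‖ < 1) (h₂ : ‖t₂‖ < 1) :
    padicEval W.formalXMulSq (padicEval₂ W.formalGroupLaw t₁ t₂) *
        (padicEval W.formalXMulSq t₁ * t₂ ^ 2 - padicEval W.formalXMulSq t₂ * t₁ ^ 2) ^ 2 *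
        t₁ ^ 2 * t₂ ^ 2 =
      padicEval₂ W.formalGroupLaw t₁ t₂ ^ 2 *
        ((padicEval W.formalXMulSq t₂ * t₁ ^ 3 - padicEval W.formalXMulSq t₁ * t₂ ^ 3) ^ 2 +
          W.a₁ * (padicEval W.formalXMulSq t₂ * t₁ ^ 3 - padicEval W.formalXMulSq t₁ * t₂ ^ 3) *
            (padicEval W.formalXMulSq t₁ * t₂ ^ 2 - padicEval W.formalXMulSq t₂ * t₁ ^ 2) * t₁ * t₂ -
          (W.a₂ * t₁ ^ 2 * t₂ ^ 2 + padicEval W.formalXMulSq t₁ * t₂ ^ 2 +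
              padicEval W.formalXMulSq t₂ * t₁ ^ 2) *
            (padicEval W.formalXMulSq t₁ * t₂ ^ 2 - padicEval W.formalXMulSq t₂ * t₁ ^ 2) ^ 2) := by
  -- `t₁ = 0` or `t₂ = 0`
  by_cases ht₁ : t₁ = 0
  · rw [ht₁, padicEval_zero_right, W.constantCoeff_formalXMulSq]; ring
  by_cases ht₂ : t₂ = 0
  · rw [ht₂, padicEval_zero_right, W.constantCoeff_formalXMulSq]; ring
  -- the points
  obtain ⟨P, hP, rfl⟩ := W.exists_isInReductionKernel_formalParameter_eq h₁
  obtain ⟨Q, hQ, rfl⟩ := W.exists_isInReductionKernel_formalParameter_eq h₂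
  rcases P with _ | ⟨x₁, y₁, hP₁⟩
  · exact absurd rfl ht₁
  rcases Q with _ | ⟨x₂, y₂, hQ₂⟩
  · exact absurd rfl ht₂
  have hx₁ : 1 < ‖x₁‖ := hP
  have hx₂ : 1 < ‖x₂‖ := hQ
  obtain ⟨hy₁, -, -, -, -⟩ := W.param_facts hP₁.1 hx₁
  obtain ⟨hy₂, -, -, -, -⟩ := W.param_facts hQ₂.1 hx₂
  have hF := formalGroupLaw_padicEval_holds p W _ _ hP hQ
  rw [formalParameter_some, formalParameter_some] at *
  rw [W.padicEval_formalXMulSq_eq hP₁.1 hx₁, W.padicEval_formalXMulSq_eq hQ₂.1 hx₂]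
  set s₁ : ℚ_[p] := -x₁ / y₁ with hs₁
  set s₂ : ℚ_[p] := -x₂ / y₂ with hs₂
  have ex₁ : x₁ = -s₁ * y₁ := by rw [hs₁]; field_simp
  have ex₂ : x₂ = -s₂ * y₂ := by rw [hs₂]; field_simp
  -- `x₁ = x₂`: `Q = ±P`
  by_cases hx : x₁ = x₂
  · rcases Affine.Y_eq_of_X_eq hP₁.1 hQ₂.1 hx with hy | hy
    · -- `Q = P`: `s₁ = s₂`
      have hs : s₁ = s₂ := by rw [hs₁, hs₂, hx, hy]
      rw [hs, hx]; ring
    · -- `Q = -P`: `F̂ = z(O) = 0`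
      rw [Affine.Point.add_of_Y_eq hx hy, formalParameter_zero] at hF
      rw [hF, hx]; ring
  -- generic case
  have hxy : ¬(x₁ = x₂ ∧ y₁ = W.toAffine.negY x₂ y₂) := fun h => hx h.1
  obtain ⟨hx₃, -⟩ := padicEval₂_formalGroupLaw_of_not_neg_aux hP₁ hQ₂ hx₁ hx₂ hxy
  rw [Affine.Point.add_some hxy, formalParameter_some] at hF
  have heq₃ := (Affine.nonsingular_add hP₁ hQ₂ hxy).1
  obtain ⟨hy₃, -, -, -, -⟩ := W.param_facts heq₃ hx₃
  have hXF := W.padicEval_formalXMulSq_eq heq₃ hx₃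
  have hchord := W.chord_addX_mul y₁ y₂ hx
  set x₃ := W.toAffine.addX x₁ x₂ (W.toAffine.slope x₁ x₂ y₁ y₂) with hx₃def
  set y₃ := W.toAffine.addY x₁ x₂ y₁ (W.toAffine.slope x₁ x₂ y₁ y₂) with hy₃def
  rw [hF, hXF]
  set f : ℚ_[p] := -x₃ / y₃ with hf
  have ex₃ : x₃ = -f * y₃ := by rw [hf]; field_simp
  rw [ex₃] at hchord ⊢
  rw [ex₁, ex₂] at hchord ⊢
  linear_combination (f ^ 2 * s₁ ^ 6 * s₂ ^ 6) * hchord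

/-- **`y(P + Q)` at a pair of parameters**:
`(−X̂(F) + a₁X̂(F)F + a₃F³)·N·t₁³t₂ = −M·(X̂(F)t₁² − X₁F²)·F + X₁·N·F³·t₂`.
[Silverman AEC III.2.3, IV.1, VII.2.2] [folklore] -/
theorem chordY_pointwise (h₁ : ‖t₁‖ < 1) (h₂ : ‖t₂‖ < 1) :
    (-padicEval W.formalXMulSq (padicEval₂ W.formalGroupLaw t₁ t₂) +
          W.a₁ * padicEval W.formalXMulSq (padicEval₂ W.formalGroupLaw t₁ t₂) *
            padicEval₂ W.formalGroupLaw t₁ t₂ +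
          W.a₃ * padicEval₂ W.formalGroupLaw t₁ t₂ ^ 3) *
        (padicEval W.formalXMulSq t₁ * t₂ ^ 2 - padicEval W.formalXMulSq t₂ * t₁ ^ 2) * t₁ ^ 3 * t₂ =
      -((padicEval W.formalXMulSq t₂ * t₁ ^ 3 - padicEval W.formalXMulSq t₁ * t₂ ^ 3) *
          (padicEval W.formalXMulSq (padicEval₂ W.formalGroupLaw t₁ t₂) * t₁ ^ 2 -
            padicEval W.formalXMulSq t₁ * padicEval₂ W.formalGroupLaw t₁ t₂ ^ 2) *
          padicEval₂ W.formalGroupLaw t₁ t₂) +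
        padicEval W.formalXMulSq t₁ *
          (padicEval W.formalXMulSq t₁ * t₂ ^ 2 - padicEval W.formalXMulSq t₂ * t₁ ^ 2) *
          padicEval₂ W.formalGroupLaw t₁ t₂ ^ 3 * t₂ := by
  -- `t₁ = 0` or `t₂ = 0`
  by_cases ht₁ : t₁ = 0
  · subst ht₁
    obtain ⟨Q, hQ, hQt⟩ := W.exists_isInReductionKernel_formalParameter_eq h₂
    have hF0 := formalGroupLaw_padicEval_holds p W 0 Q W.isInReductionKernel_zero hQ
    rw [zero_add, formalParameter_zero, hQt] at hF0
    rw [hF0, padicEval_zero_right, W.constantCoeff_formalXMulSq]; ring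
  by_cases ht₂ : t₂ = 0
  · subst ht₂
    obtain ⟨P, hP, hPt⟩ := W.exists_isInReductionKernel_formalParameter_eq h₁
    have hF0 := formalGroupLaw_padicEval_holds p W P 0 hP W.isInReductionKernel_zero
    rw [add_zero, formalParameter_zero, hPt] at hF0
    rw [hF0, padicEval_zero_right, W.constantCoeff_formalXMulSq]; ring
  -- the points
  obtain ⟨P, hP, rfl⟩ := W.exists_isInReductionKernel_formalParameter_eq h₁
  obtain ⟨Q, hQ, rfl⟩ := W.exists_isInReductionKernel_formalParameter_eq h₂
  rcases P with _ | ⟨x₁, y₁, hP₁⟩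
  · exact absurd rfl ht₁
  rcases Q with _ | ⟨x₂, y₂, hQ₂⟩
  · exact absurd rfl ht₂
  have hx₁ : 1 < ‖x₁‖ := hP
  have hx₂ : 1 < ‖x₂‖ := hQ
  obtain ⟨hy₁, -, -, -, -⟩ := W.param_facts hP₁.1 hx₁
  obtain ⟨hy₂, -, -, -, -⟩ := W.param_facts hQ₂.1 hx₂
  have hF := formalGroupLaw_padicEval_holds p W _ _ hP hQ
  rw [formalParameter_some, formalParameter_some] at *
  rw [W.padicEval_formalXMulSq_eq hP₁.1 hx₁, W.padicEval_formalXMulSq_eq hQ₂.1 hx₂]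
  set s₁ : ℚ_[p] := -x₁ / y₁ with hs₁
  set s₂ : ℚ_[p] := -x₂ / y₂ with hs₂
  have ex₁ : x₁ = -s₁ * y₁ := by rw [hs₁]; field_simp
  have ex₂ : x₂ = -s₂ * y₂ := by rw [hs₂]; field_simp
  -- `x₁ = x₂`: `Q = ±P`
  by_cases hx : x₁ = x₂
  · rcases Affine.Y_eq_of_X_eq hP₁.1 hQ₂.1 hx with hy | hy
    · have hs : s₁ = s₂ := by rw [hs₁, hs₂, hx, hy]
      rw [hs, hx]; ring
    · rw [Affine.Point.add_of_Y_eq hx hy, formalParameter_zero] at hF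
      rw [hF, hx]; ring
  -- generic case
  have hxy : ¬(x₁ = x₂ ∧ y₁ = W.toAffine.negY x₂ y₂) := fun h => hx h.1
  obtain ⟨hx₃, -⟩ := padicEval₂_formalGroupLaw_of_not_neg_aux hP₁ hQ₂ hx₁ hx₂ hxy
  rw [Affine.Point.add_some hxy, formalParameter_some] at hF
  have heq₃ := (Affine.nonsingular_add hP₁ hQ₂ hxy).1
  obtain ⟨hy₃, -, -, -, -⟩ := W.param_facts heq₃ hx₃
  have hXF := W.padicEval_formalXMulSq_eq heq₃ hx₃
  have hchord := W.chord_addY_mul y₁ y₂ hx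
  set x₃ := W.toAffine.addX x₁ x₂ (W.toAffine.slope x₁ x₂ y₁ y₂) with hx₃def
  set y₃ := W.toAffine.addY x₁ x₂ y₁ (W.toAffine.slope x₁ x₂ y₁ y₂) with hy₃def
  rw [hF, hXF]
  set f : ℚ_[p] := -x₃ / y₃ with hf
  have ex₃ : x₃ = -f * y₃ := by rw [hf]; field_simp
  rw [ex₃] at hchord ⊢
  rw [ex₁, ex₂] at hchord ⊢
  linear_combination (f ^ 3 * s₁ ^ 5 * s₂ ^ 3) * hchord

/-- **`x(2P)` at a parameter**: with `X = X̂(t)`, `D = [2]^(t)`, `Ỹ = (a₁t − 2)X + a₃t³`,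
`Mt = 3X² + 2a₂t²X + a₄t⁴ + a₁tX`: `X̂(D)·t²·Ỹ² = D²·(Mt² + a₁·Mt·t·Ỹ − a₂t²Ỹ² − 2XỸ²)`.
At `t = z(P)` with `2P ≠ O` this is `tangent_addX_mul` transported by the dictionary
(`[2]^(z(P)) = z(2P)`); if `t = 0` or `2P = O` both sides vanish.
[Silverman AEC III.2.3, IV.2, VII.2.2] [folklore] -/
theorem doubleX_pointwise {t : ℚ_[p]} (ht : ‖t‖ < 1) :
    padicEval W.formalXMulSq (padicEval (W.formalMul 2) t) * t ^ 2 *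
        ((W.a₁ * t - 2) * padicEval W.formalXMulSq t + W.a₃ * t ^ 3) ^ 2 =
      padicEval (W.formalMul 2) t ^ 2 *
        ((3 * padicEval W.formalXMulSq t ^ 2 + 2 * W.a₂ * t ^ 2 * padicEval W.formalXMulSq t +
              W.a₄ * t ^ 4 + W.a₁ * t * padicEval W.formalXMulSq t) ^ 2 +
            W.a₁ * (3 * padicEval W.formalXMulSq t ^ 2 + 2 * W.a₂ * t ^ 2 * padicEval W.formalXMulSq t +
              W.a₄ * t ^ 4 + W.a₁ * t * padicEval W.formalXMulSq t) * t *
              ((W.a₁ * t - 2) * padicEval W.formalXMulSq t + W.a₃ * t ^ 3) -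
          W.a₂ * t ^ 2 * ((W.a₁ * t - 2) * padicEval W.formalXMulSq t + W.a₃ * t ^ 3) ^ 2 -
          2 * padicEval W.formalXMulSq t * ((W.a₁ * t - 2) * padicEval W.formalXMulSq t + W.a₃ * t ^ 3) ^ 2) := by
  by_cases ht0 : t = 0
  · subst ht0
    simp only [padicEval_zero_right, constantCoeff_formalMul, W.constantCoeff_formalXMulSq]; ring
  obtain ⟨P, hP, rfl⟩ := W.exists_isInReductionKernel_formalParameter_eq ht
  rcases P with _ | ⟨x, y, hP₁⟩
  · exact absurd rfl ht0
  have hx : 1 < ‖x‖ := hP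
  obtain ⟨hy0, -, -, -, -⟩ := W.param_facts hP₁.1 hx
  have hD := W.padicEval_formalMul_formalParameter 2 hP
  rw [two_smul] at hD
  rw [formalParameter_some] at *
  rw [W.padicEval_formalXMulSq_eq hP₁.1 hx]
  set s : ℚ_[p] := -x / y with hs
  have ex : x = -s * y := by rw [hs]; field_simp
  by_cases hy : y = W.toAffine.negY x y
  · -- `2P = O`
    rw [Affine.Point.add_of_Y_eq rfl hy, formalParameter_zero] at hD
    have h2 : 2 * y + W.a₁ * x + W.a₃ = 0 := by
      rw [Affine.negY] at hy; linear_combination hy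
    have hYt : (W.a₁ * s - 2) * (x * s ^ 2) + W.a₃ * s ^ 3 = 0 := by
      rw [ex] at h2 ⊢; linear_combination s ^ 3 * h2
    rw [hD, hYt]; ring
  -- `2P ≠ O`
  have hxy : ¬(x = x ∧ y = W.toAffine.negY x y) := fun h => hy h.2
  obtain ⟨hx₄, -⟩ := padicEval₂_formalGroupLaw_of_not_neg_aux hP₁ hP₁ hx hx hxy
  rw [Affine.Point.add_some hxy, formalParameter_some] at hD
  have heq₄ := (Affine.nonsingular_add hP₁ hP₁ hxy).1
  obtain ⟨hy₄, -, -, -, -⟩ := W.param_facts heq₄ hx₄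
  have htan := W.tangent_addX_mul hy
  simp only [Affine.negY] at htan
  set x₄ := W.toAffine.addX x x (W.toAffine.slope x x y y) with hx₄def
  set y₄ := W.toAffine.addY x x y (W.toAffine.slope x x y y) with hy₄def
  rw [hD, W.padicEval_formalXMulSq_eq heq₄ hx₄]
  set d : ℚ_[p] := -x₄ / y₄ with hd
  have ex₄ : x₄ = -d * y₄ := by rw [hd]; field_simp
  rw [ex₄] at htan ⊢
  rw [ex] at htan ⊢
  linear_combination (d ^ 2 * s ^ 8) * htan

/-- **`y(2P)` at a parameter**:
`(−X̂(D) + a₁X̂(D)D + a₃D³)·t³·Ỹ = −Mt·(X̂(D)t² − X·D²)·D + X·D³·Ỹ`.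
[Silverman AEC III.2.3, IV.2, VII.2.2] [folklore] -/
theorem doubleY_pointwise {t : ℚ_[p]} (ht : ‖t‖ < 1) :
    (-padicEval W.formalXMulSq (padicEval (W.formalMul 2) t) +
          W.a₁ * padicEval W.formalXMulSq (padicEval (W.formalMul 2) t) * padicEval (W.formalMul 2) t +
          W.a₃ * padicEval (W.formalMul 2) t ^ 3) * t ^ 3 *
        ((W.a₁ * t - 2) * padicEval W.formalXMulSq t + W.a₃ * t ^ 3) =
      -((3 * padicEval W.formalXMulSq t ^ 2 + 2 * W.a₂ * t ^ 2 * padicEval W.formalXMulSq t +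
              W.a₄ * t ^ 4 + W.a₁ * t * padicEval W.formalXMulSq t) *
          (padicEval W.formalXMulSq (padicEval (W.formalMul 2) t) * t ^ 2 -
            padicEval W.formalXMulSq t * padicEval (W.formalMul 2) t ^ 2) *
          padicEval (W.formalMul 2) t) +
        padicEval W.formalXMulSq t * padicEval (W.formalMul 2) t ^ 3 *
          ((W.a₁ * t - 2) * padicEval W.formalXMulSq t + W.a₃ * t ^ 3) := by
  by_cases ht0 : t = 0
  · subst ht0
    simp only [padicEval_zero_right, constantCoeff_formalMul, W.constantCoeff_formalXMulSq]; ring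
  obtain ⟨P, hP, rfl⟩ := W.exists_isInReductionKernel_formalParameter_eq ht
  rcases P with _ | ⟨x, y, hP₁⟩
  · exact absurd rfl ht0
  have hx : 1 < ‖x‖ := hP
  obtain ⟨hy0, -, -, -, -⟩ := W.param_facts hP₁.1 hx
  have hD := W.padicEval_formalMul_formalParameter 2 hP
  rw [two_smul] at hD
  rw [formalParameter_some] at *
  rw [W.padicEval_formalXMulSq_eq hP₁.1 hx]
  set s : ℚ_[p] := -x / y with hs
  have ex : x = -s * y := by rw [hs]; field_simp
  by_cases hy : y = W.toAffine.negY x y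
  · -- `2P = O`
    rw [Affine.Point.add_of_Y_eq rfl hy, formalParameter_zero] at hD
    have h2 : 2 * y + W.a₁ * x + W.a₃ = 0 := by
      rw [Affine.negY] at hy; linear_combination hy
    have hYt : (W.a₁ * s - 2) * (x * s ^ 2) + W.a₃ * s ^ 3 = 0 := by
      rw [ex] at h2 ⊢; linear_combination s ^ 3 * h2
    rw [hD, hYt]; ring
  -- `2P ≠ O`
  have hxy : ¬(x = x ∧ y = W.toAffine.negY x y) := fun h => hy h.2
  obtain ⟨hx₄, -⟩ := padicEval₂_formalGroupLaw_of_not_neg_aux hP₁ hP₁ hx hx hxy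
  rw [Affine.Point.add_some hxy, formalParameter_some] at hD
  have heq₄ := (Affine.nonsingular_add hP₁ hP₁ hxy).1
  obtain ⟨hy₄, -, -, -, -⟩ := W.param_facts heq₄ hx₄
  have htan := W.tangent_addY_mul hy
  simp only [Affine.negY] at htan
  set x₄ := W.toAffine.addX x x (W.toAffine.slope x x y y) with hx₄def
  set y₄ := W.toAffine.addY x x y (W.toAffine.slope x x y y) with hy₄def
  rw [hD, W.padicEval_formalXMulSq_eq heq₄ hx₄]
  set d : ℚ_[p] := -x₄ / y₄ with hd
  have ex₄ : x₄ = -d * y₄ := by rw [hd]; field_simp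
  rw [ex₄] at htan ⊢
  rw [ex] at htan ⊢
  linear_combination (d ^ 3 * s ^ 6) * htan

end Pointwise

/-! ### The formal identities over `ℤ_p` -/

section Formal

variable {p : ℕ} [Fact p.Prime] (V : WeierstrassCurve ℤ_[p])
  [hE : (V.map PadicInt.Coe.ringHom).IsElliptic]

/-- **`x(u +_F v)` formally.** In `ℤ_p⟦u, v⟧`, with `X₀ = X(u)`, `X₁ = X(v)`, `F = formalGroupLaw`,
`N = X₀v² − X₁u²`, `M = X₁u³ − X₀v³`:
`X(F)·N²·u²v² = F²·(M² + a₁MNuv − (a₂u²v² + X₀v² + X₁u²)·N²)` — the chord formula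
`x₃(x₁ − x₂)² = (y₁ − y₂)² + a₁(y₁ − y₂)(x₁ − x₂) − (a₂ + x₁ + x₂)(x₁ − x₂)²` for the formal points
`(X(u)/u², −X(u)/u³)`, `(X(v)/v², −X(v)/v³)` with sum `(X(F)/F², −X(F)/F³)`, poles cleared.
[Silverman AEC III.2.3 with IV.1 ("the power series … formally giving the addition law")]
[cite: SilvermanAEC2009, IV.1] -/
theorem formalXMulSq_formalGroupLaw_chord :
    V.formalXMulSq.subst V.formalGroupLaw *
        (V.formalXMulSq.subst (MvPowerSeries.X 0 : MvPowerSeries (Fin 2) ℤ_[p]) *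
              (MvPowerSeries.X 1 : MvPowerSeries (Fin 2) ℤ_[p]) ^ 2 -
            V.formalXMulSq.subst (MvPowerSeries.X 1 : MvPowerSeries (Fin 2) ℤ_[p]) *
              (MvPowerSeries.X 0 : MvPowerSeries (Fin 2) ℤ_[p]) ^ 2) ^ 2 *
        (MvPowerSeries.X 0 : MvPowerSeries (Fin 2) ℤ_[p]) ^ 2 *
        (MvPowerSeries.X 1 : MvPowerSeries (Fin 2) ℤ_[p]) ^ 2 =
      V.formalGroupLaw ^ 2 *
        ((V.formalXMulSq.subst (MvPowerSeries.X 1 : MvPowerSeries (Fin 2) ℤ_[p]) *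
                (MvPowerSeries.X 0 : MvPowerSeries (Fin 2) ℤ_[p]) ^ 3 -
              V.formalXMulSq.subst (MvPowerSeries.X 0 : MvPowerSeries (Fin 2) ℤ_[p]) *
                (MvPowerSeries.X 1 : MvPowerSeries (Fin 2) ℤ_[p]) ^ 3) ^ 2 +
            MvPowerSeries.C V.a₁ *
              (V.formalXMulSq.subst (MvPowerSeries.X 1 : MvPowerSeries (Fin 2) ℤ_[p]) *
                  (MvPowerSeries.X 0 : MvPowerSeries (Fin 2) ℤ_[p]) ^ 3 -
                V.formalXMulSq.subst (MvPowerSeries.X 0 : MvPowerSeries (Fin 2) ℤ_[p]) *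
                  (MvPowerSeries.X 1 : MvPowerSeries (Fin 2) ℤ_[p]) ^ 3) *
              (V.formalXMulSq.subst (MvPowerSeries.X 0 : MvPowerSeries (Fin 2) ℤ_[p]) *
                  (MvPowerSeries.X 1 : MvPowerSeries (Fin 2) ℤ_[p]) ^ 2 -
                V.formalXMulSq.subst (MvPowerSeries.X 1 : MvPowerSeries (Fin 2) ℤ_[p]) *
                  (MvPowerSeries.X 0 : MvPowerSeries (Fin 2) ℤ_[p]) ^ 2) *
              (MvPowerSeries.X 0 : MvPowerSeries (Fin 2) ℤ_[p]) *
              (MvPowerSeries.X 1 : MvPowerSeries (Fin 2) ℤ_[p]) -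
          (MvPowerSeries.C V.a₂ * (MvPowerSeries.X 0 : MvPowerSeries (Fin 2) ℤ_[p]) ^ 2 *
                (MvPowerSeries.X 1 : MvPowerSeries (Fin 2) ℤ_[p]) ^ 2 +
              V.formalXMulSq.subst (MvPowerSeries.X 0 : MvPowerSeries (Fin 2) ℤ_[p]) *
                (MvPowerSeries.X 1 : MvPowerSeries (Fin 2) ℤ_[p]) ^ 2 +
              V.formalXMulSq.subst (MvPowerSeries.X 1 : MvPowerSeries (Fin 2) ℤ_[p]) *
                (MvPowerSeries.X 0 : MvPowerSeries (Fin 2) ℤ_[p]) ^ 2) *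
            (V.formalXMulSq.subst (MvPowerSeries.X 0 : MvPowerSeries (Fin 2) ℤ_[p]) *
                  (MvPowerSeries.X 1 : MvPowerSeries (Fin 2) ℤ_[p]) ^ 2 -
                V.formalXMulSq.subst (MvPowerSeries.X 1 : MvPowerSeries (Fin 2) ℤ_[p]) *
                  (MvPowerSeries.X 0 : MvPowerSeries (Fin 2) ℤ_[p]) ^ 2) ^ 2) := by
  apply eq_of_evalHom₂_eq
  intro u v hu hv
  refine Subtype.ext ?_
  simp only [map_mul, map_pow, map_add, map_sub, evalHom₂_X, evalHom₂_C, Matrix.cons_val_zero,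
    Matrix.cons_val_one, PadicInt.coe_mul, PadicInt.coe_pow, PadicInt.coe_add,
    PadicInt.coe_sub, evalHom₂_formalXMulSq_subst_X, evalHom₂_formalGroupLaw,
    evalHom₂_formalXMulSq_subst_formalGroupLaw]
  have hu' : ‖(u : ℚ_[p])‖ < 1 := hu
  have hv' : ‖(v : ℚ_[p])‖ < 1 := hv
  haveI := V.isIntegral_map_coe
  have h := chordX_pointwise (W := V.map PadicInt.Coe.ringHom) hu' hv'
  simp only [map_a₁, map_a₂] at h
  exact h

/-- **`y(u +_F v)` formally**: `(−X(F) + a₁X(F)F + a₃F³)·N·u³v = −M·(X(F)u² − X₀F²)·F + X₀·N·F³·v`,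
i.e. `(y₃ + a₁x₃ + a₃)(x₁ − x₂) = −(y₁ − y₂)(x₃ − x₁) − y₁(x₁ − x₂)` for the formal points, poles
cleared (`y(z) = −X(z)/z³`). [Silverman AEC III.2.3 with IV.1] [cite: SilvermanAEC2009, IV.1] -/
theorem formalXMulSq_formalGroupLaw_chordY :
    (-V.formalXMulSq.subst V.formalGroupLaw +
          MvPowerSeries.C V.a₁ * V.formalXMulSq.subst V.formalGroupLaw * V.formalGroupLaw +
          MvPowerSeries.C V.a₃ * V.formalGroupLaw ^ 3) *
        (V.formalXMulSq.subst (MvPowerSeries.X 0 : MvPowerSeries (Fin 2) ℤ_[p]) *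
              (MvPowerSeries.X 1 : MvPowerSeries (Fin 2) ℤ_[p]) ^ 2 -
            V.formalXMulSq.subst (MvPowerSeries.X 1 : MvPowerSeries (Fin 2) ℤ_[p]) *
              (MvPowerSeries.X 0 : MvPowerSeries (Fin 2) ℤ_[p]) ^ 2) *
        (MvPowerSeries.X 0 : MvPowerSeries (Fin 2) ℤ_[p]) ^ 3 *
        (MvPowerSeries.X 1 : MvPowerSeries (Fin 2) ℤ_[p]) =
      -((V.formalXMulSq.subst (MvPowerSeries.X 1 : MvPowerSeries (Fin 2) ℤ_[p]) *
              (MvPowerSeries.X 0 : MvPowerSeries (Fin 2) ℤ_[p]) ^ 3 -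
            V.formalXMulSq.subst (MvPowerSeries.X 0 : MvPowerSeries (Fin 2) ℤ_[p]) *
              (MvPowerSeries.X 1 : MvPowerSeries (Fin 2) ℤ_[p]) ^ 3) *
          (V.formalXMulSq.subst V.formalGroupLaw * (MvPowerSeries.X 0 : MvPowerSeries (Fin 2) ℤ_[p]) ^ 2 -
            V.formalXMulSq.subst (MvPowerSeries.X 0 : MvPowerSeries (Fin 2) ℤ_[p]) * V.formalGroupLaw ^ 2) *
          V.formalGroupLaw) +
        V.formalXMulSq.subst (MvPowerSeries.X 0 : MvPowerSeries (Fin 2) ℤ_[p]) *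
          (V.formalXMulSq.subst (MvPowerSeries.X 0 : MvPowerSeries (Fin 2) ℤ_[p]) *
              (MvPowerSeries.X 1 : MvPowerSeries (Fin 2) ℤ_[p]) ^ 2 -
            V.formalXMulSq.subst (MvPowerSeries.X 1 : MvPowerSeries (Fin 2) ℤ_[p]) *
              (MvPowerSeries.X 0 : MvPowerSeries (Fin 2) ℤ_[p]) ^ 2) *
          V.formalGroupLaw ^ 3 * (MvPowerSeries.X 1 : MvPowerSeries (Fin 2) ℤ_[p]) := by
  apply eq_of_evalHom₂_eq
  intro u v hu hv
  refine Subtype.ext ?_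
  simp only [map_mul, map_pow, map_add, map_sub, map_neg, evalHom₂_X, evalHom₂_C,
    Matrix.cons_val_zero, Matrix.cons_val_one, PadicInt.coe_mul, PadicInt.coe_pow, PadicInt.coe_add,
    PadicInt.coe_sub, PadicInt.coe_neg, evalHom₂_formalXMulSq_subst_X, evalHom₂_formalGroupLaw,
    evalHom₂_formalXMulSq_subst_formalGroupLaw]
  have hu' : ‖(u : ℚ_[p])‖ < 1 := hu
  have hv' : ‖(v : ℚ_[p])‖ < 1 := hv
  haveI := V.isIntegral_map_coe
  have h := chordY_pointwise (W := V.map PadicInt.Coe.ringHom) hu' hv'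
  simp only [map_a₁, map_a₃] at h
  exact h

/-- **`x([2]t)` formally.** In `ℤ_p⟦t⟧`, with `X = formalXMulSq`, `D = [2](t) = formalMul 2`,
`Ỹ = (a₁t − 2)X + a₃t³` (`= t³(2y + a₁x + a₃)`) and `Mt = 3X² + 2a₂t²X + a₄t⁴ + a₁tX`
(`= t⁴(3x² + 2a₂x + a₄ − a₁y)`):
`X(D)·t²·Ỹ² = D²·(Mt² + a₁·Mt·t·Ỹ − a₂t²Ỹ² − 2XỸ²)` — the duplication formula
`x(2P)(2y + a₁x + a₃)² = N² + a₁N(2y + a₁x + a₃) − (a₂ + 2x)(2y + a₁x + a₃)²` for the formal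
point, poles cleared. [Silverman AEC III.2.3 (duplication) with IV.2 (`[2](t) = F(t, t)`)]
[cite: SilvermanAEC2009, IV.2] -/
theorem formalXMulSq_formalMul_two :
    V.formalXMulSq.subst (V.formalMul 2) * X ^ 2 *
        ((C V.a₁ * X - 2) * V.formalXMulSq + C V.a₃ * X ^ 3) ^ 2 =
      V.formalMul 2 ^ 2 *
        ((3 * V.formalXMulSq ^ 2 + 2 * C V.a₂ * X ^ 2 * V.formalXMulSq + C V.a₄ * X ^ 4 +
              C V.a₁ * X * V.formalXMulSq) ^ 2 +
            C V.a₁ * (3 * V.formalXMulSq ^ 2 + 2 * C V.a₂ * X ^ 2 * V.formalXMulSq + C V.a₄ * X ^ 4 +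
              C V.a₁ * X * V.formalXMulSq) * X * ((C V.a₁ * X - 2) * V.formalXMulSq + C V.a₃ * X ^ 3) -
          C V.a₂ * X ^ 2 * ((C V.a₁ * X - 2) * V.formalXMulSq + C V.a₃ * X ^ 3) ^ 2 -
          2 * V.formalXMulSq * ((C V.a₁ * X - 2) * V.formalXMulSq + C V.a₃ * X ^ 3) ^ 2) := by
  apply eq_of_evalHom_eq
  intro t ht
  refine Subtype.ext ?_
  simp only [map_mul, map_pow, map_add, map_sub, map_ofNat, evalHom_X, evalHom_C, PadicInt.coe_mul,
    PadicInt.coe_pow, PadicInt.coe_add, PadicInt.coe_sub, evalHom_formalXMulSq,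
    evalHom_formalMul_two, evalHom_formalXMulSq_subst_formalMul_two]
  have ht' : ‖(t : ℚ_[p])‖ < 1 := ht
  haveI := V.isIntegral_map_coe
  have h := doubleX_pointwise (W := V.map PadicInt.Coe.ringHom) ht'
  simp only [map_a₁, map_a₂, map_a₃, map_a₄] at h
  exact h

/-- **`y([2]t)` formally**: `(−X(D) + a₁X(D)D + a₃D³)·t³·Ỹ = −Mt·(X(D)t² − X·D²)·D + X·D³·Ỹ`, i.e.
`(y(2P) + a₁x(2P) + a₃)(2y + a₁x + a₃) = −N·(x(2P) − x) − y(2y + a₁x + a₃)` for the formal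
point, poles cleared. [Silverman AEC III.2.3 (duplication) with IV.2] [cite: SilvermanAEC2009, IV.2] -/
theorem formalXMulSq_formalMul_twoY :
    (-V.formalXMulSq.subst (V.formalMul 2) +
          C V.a₁ * V.formalXMulSq.subst (V.formalMul 2) * V.formalMul 2 + C V.a₃ * V.formalMul 2 ^ 3) *
        X ^ 3 * ((C V.a₁ * X - 2) * V.formalXMulSq + C V.a₃ * X ^ 3) =
      -((3 * V.formalXMulSq ^ 2 + 2 * C V.a₂ * X ^ 2 * V.formalXMulSq + C V.a₄ * X ^ 4 +
              C V.a₁ * X * V.formalXMulSq) *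
          (V.formalXMulSq.subst (V.formalMul 2) * X ^ 2 - V.formalXMulSq * V.formalMul 2 ^ 2) *
          V.formalMul 2) +
        V.formalXMulSq * V.formalMul 2 ^ 3 * ((C V.a₁ * X - 2) * V.formalXMulSq + C V.a₃ * X ^ 3) := by
  apply eq_of_evalHom_eq
  intro t ht
  refine Subtype.ext ?_
  simp only [map_mul, map_pow, map_add, map_sub, map_neg, map_ofNat, evalHom_X, evalHom_C,
    PadicInt.coe_mul, PadicInt.coe_pow, PadicInt.coe_add, PadicInt.coe_sub, PadicInt.coe_neg,
    evalHom_formalXMulSq, evalHom_formalMul_two,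
    evalHom_formalXMulSq_subst_formalMul_two]
  have ht' : ‖(t : ℚ_[p])‖ < 1 := ht
  haveI := V.isIntegral_map_coe
  have h := doubleY_pointwise (W := V.map PadicInt.Coe.ringHom) ht'
  simp only [map_a₁, map_a₂, map_a₃, map_a₄] at h
  exact h

end Formal

end WeierstrassCurve
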